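import Summits.ResolutionOfSingularities.ResolutionOfSingularities.Theorems.EquisingularLiftEquisingularLiftNatSubchainPointResolutionOff
import HarnessLib

/-!
# [OURS · L1 W4.5(b) · EL♮(3)] HSUB′(ReachTC⁺) FROM AN INVARIANT — the induction DRIVER of the sub-chain supplier for v7 (TC⁺)
# (registered stub `stub_elnat_tcPlusPointResolution`, skeleton v7.1 8bec013ff8e4e739 / child v4.1 12ce0fce3689b843; TC⁺-INST p524774 over
# K5′ `target_elnat_of_subchainResolution'`; frozen target HSUB′ = `L/res-L1-w45b-lead-2/HSUB-ReachTCplus-K5prime.txt` 098f173ea69df134)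

Crux `EquisingularLiftNat` = stmt-ResolutionOfSingularities-20038 (child EL♮(3) = stmt-ResolutionOfSingularities-20148), route
EquisingularLift, line `sections`. Helper file `--supports stmt-ResolutionOfSingularities-20148 --as helper` by res-L1-w45b-stub-1
(HSUB(ReachTC⁺) assembly, res-L1-w45b-lead-2 GO 2026-08-27T10:45:46Z; skeleton `L/res-L1-w45b-stub-1/HSUB-TCPLUS3-skeleton.lean`).
HONEST FRAMING: OURS (cell res-hironaka, slot W4.5(b)); NOT a statement of any manuscript; AI-written, weaker than expert review.
No `sorry`; standard axioms.

WHAT. `hsub_reachTCPlus_of_invariant`: the frozen supplier text HSUB′(ReachTC⁺) with, inserted before its last quantifier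
`∀ (F₁₀) (β) (T₁₀)`, FOUR hypotheses on an INVARIANT `INV W G β T Z b` of the inner chain (base after the point step / step at a
regular point of the running curve / step at the non-regular point / the curve step from the invariant) — and the proof that these four
give HSUB′: unpack `ReachTC⁺`, run the inner `∀R`-closure at `R := INV W`, finish with the curve step. Pure logic; it FIXES THE
INTERFACES of the four bricks of the assembly (`inv_base`, `inv_step_regular`, `inv_step_singular`, `inv_final` =
…NatInCarrierCurveStep `curveStep_of_centre`, p525565) so that they can be built independently and by different hands. The intended
`INV` (alive-member bookkeeping over the candidate centres `q′ ∈ Z₂` plus the uncentred member, each member an in-carrier pair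
`St(𝓢) ⊔ St(K)` with exact special fibre, `O`-flat, regular quotient stalks off one `O`-point, and the centred Δ-package of
T-ΔLIFT-CENTRED p523916) is described in the skeleton; this file is agnostic of it.

References: res-D-pv-029 K5′ (…NatSubchainPointResolutionOff), supplier template `hsub_of_carrierLift` (p523971); res-L1-w45b-lead-2
TC⁺-INST (p524774) and HSUB-ReachTCplus-K5prime.txt (OURS planning texts, index only).
-/

set_option linter.dupNamespace false -- mandated namespace `Summit.<Summit>.<Problem>` of this single-conjunct summit
set_option linter.overlappingInstances false -- signatures carry `[IsDomain O] [IsDiscreteValuationRing O]`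

noncomputable section

open CategoryTheory CategoryTheory.Limits AlgebraicGeometry TopologicalSpace Topology
open Literature.AlgebraicGeometry.Resolution
open AlgebraicGeometry.Scheme.IdealSheafData

namespace Summit.ResolutionOfSingularities.ResolutionOfSingularities.Cruxes.EquisingularLiftNat.Sections

/-- **HSUB′(ReachTC⁺) from an invariant of the inner chain** (the induction driver; see the module docstring).
[folklore; pure logic over res-D-pv-029's K5′ binders] [OURS · L1 W4.5b] toward `stub_elnat_tcPlusPointResolution`; NOT a statement of
the manuscript. -/
theorem hsub_reachTCPlus_of_invariant (k : Type) [Field k] (n : ℕ) :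
    ∀ (O : Type) [CommRing O] [IsDomain O] [IsDiscreteValuationRing O] [IsAdicComplete (IsLocalRing.maximalIdeal O) O] [IsAlgClosed (IsLocalRing.ResidueField O)] (θ : O →+* k), Function.Surjective θ → ∀ (P : AlgebraicGeometry.Scheme.{0}) (q : P ⟶ AlgebraicGeometry.Spec (.of O)) (Y : Set P) (Ch : ∀ X' : AlgebraicGeometry.Scheme.{0}, (X' ⟶ P) → Set X' → Prop), (∀ (X' X'' : AlgebraicGeometry.Scheme.{0}) (σ' : X' ⟶ P) (S' : Set X') (C : X'.IdealSheafData) (τ : X'' ⟶ X'), Ch X' σ' S' → Literature.AlgebraicGeometry.Resolution.IsBlowup τ C → Literature.AlgebraicGeometry.Resolution.Scheme.IsRegular C.subscheme → AlgebraicGeometry.Flat (C.subschemeι ≫ σ' ≫ q) → σ' '' (C.support : Set X') ⊆ {y | ¬ IsGenericPoint y Y} → (C.support : Set X') ∩ (σ' ≫ q) ⁻¹' {IsLocalRing.closedPoint O} ⊆ S' → Ch X'' (τ ≫ σ') (closure (τ ⁻¹' (S' \ (C.support : Set X'))))) → (∀ (X' : AlgebraicGeometry.Scheme.{0}) (σ'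 : X' ⟶ P) (S' : Set X'), Ch X' σ' S' → Summit.ResolutionOfSingularities.ResolutionOfSingularities.Theses.EquisingularLift.Split.Chain P Y X' σ' S') → Y ⊆ q ⁻¹' {IsLocalRing.closedPoint O} → IsIrreducible Y → IsClosed Y → AlgebraicGeometry.IsIntegral P → IsLocallyNoetherian P → Literature.AlgebraicGeometry.Resolution.Scheme.IsRegular P → AlgebraicGeometry.IsProper q → AlgebraicGeometry.SmoothOfRelativeDimension n q → ∀ (X' : AlgebraicGeometry.Scheme.{0}) (σ' : X' ⟶ P) (S' : Set X'), Ch X' σ' S' → AlgebraicGeometry.IsIntegral X' → IsLocallyNoetherian X' → Literature.AlgebraicGeometry.Resolution.Scheme.IsRegular X' → AlgebraicGeometry.IsDominant (σ' ≫ q) → ∀ (F₁ : AlgebraicGeometry.Scheme.{0}), AlgebraicGeometry.IsIntegral F₁ → ∀ (j : F₁ ⟶ X') (t : F₁ ⟶ AlgebraicGeometry.Spec (.of k)), IsPullback j t (σ' ≫ q) (AlgebraicGeometry.Spec.map (CommRingCat.ofHom θ)) → ∀ (T₁ : Set F₁), IsClosed T₁ → IsIrreducible T₁ → j '' T₁ =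 S' → ∀ (x : F₁) (hx : IsClosed ({x} : Set F₁)) (U : X'.Opens), AlgebraicGeometry.Smooth (U.ι ≫ σ' ≫ q) → ∀ (s : AlgebraicGeometry.Spec (.of O) ⟶ X'), s ≫ σ' ≫ q = 𝟙 _ → s (IsLocalRing.closedPoint O) ∈ U → s (IsLocalRing.closedPoint O) = j x → ringKrullDim (X'.presheaf.stalk (s (IsLocalRing.closedPoint O))) = ((n + 1 : ℕ) : WithBot ℕ∞) → IsRegularLocalRing (F₁.presheaf.stalk x) → (∀ c ∈ (s.ker.support : Set X'), ¬ IsGenericPoint (σ' c) Y) → ∀ (X₁ : AlgebraicGeometry.Scheme.{0}) (τ₁ : X₁ ⟶ X'), Literature.AlgebraicGeometry.Resolution.IsBlowup τ₁ s.ker → AlgebraicGeometry.IsIntegral X₁ → IsLocallyNoetherian X₁ → Literature.AlgebraicGeometry.Resolution.Scheme.IsRegular X₁ → AlgebraicGeometry.IsDominant ((τ₁ ≫ σ') ≫ q) → ∀ (F₂ : AlgebraicGeometry.Scheme.{0}), AlgebraicGeometry.IsIntegral F₂ → ∀ (υ : F₂ ⟶ F₁), Literature.AlgebraicGeometry.Resolution.IsBlowup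 υ (AlgebraicGeometry.Scheme.IdealSheafData.vanishingIdeal (⟨{x}, hx⟩ : TopologicalSpace.Closeds F₁)) → ∀ (j₂ : F₂ ⟶ X₁) (t₂ : F₂ ⟶ AlgebraicGeometry.Spec (.of k)), IsPullback j₂ t₂ ((τ₁ ≫ σ') ≫ q) (AlgebraicGeometry.Spec.map (CommRingCat.ofHom θ)) → j₂ ≫ τ₁ = υ ≫ j → (s.ker.comap τ₁).comap j₂ = (AlgebraicGeometry.Scheme.IdealSheafData.vanishingIdeal (⟨{x}, hx⟩ : TopologicalSpace.Closeds F₁)).comap υ → IsIrreducible (closure (υ ⁻¹' (T₁ \ {x}))) → Ch X₁ (τ₁ ≫ σ') (j₂ '' closure (υ ⁻¹' (T₁ \ {x}))) → ∀ (INV : Set F₁ → ∀ G : AlgebraicGeometry.Scheme.{0}, (G ⟶ F₂) → Set G → Set G → Bool → Prop),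
      -- (base) the invariant after the point step, for every admissible `W`
      (∀ W : Set F₁, (x ∈ W) → (¬ (υ ⁻¹' {x} ⊆ closure (υ ⁻¹' (W \ {x})))) → ((∃ U : F₁.affineOpens, x ∈ (U : F₁.Opens) ∧ ((AlgebraicGeometry.Scheme.IdealSheafData.vanishingIdeal (⟨closure W, isClosed_closure⟩ : TopologicalSpace.Closeds F₁)).ideal U).IsPrincipal)) → ((υ ⁻¹' {x} ∩ closure (υ ⁻¹' (W \ {x}))) ⊆ closure (υ ⁻¹' (T₁ \ {x}))) → INV W F₂ (CategoryTheory.CategoryStruct.id F₂) (closure (υ ⁻¹' (T₁ \ {x}))) (υ ⁻¹' {x} ∩ closure (υ ⁻¹' (W \ {x}))) false) →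
      -- (step, flag kept) an in-carrier point blow-up at a REGULAR point of the running curve
      (∀ W : Set F₁, (∀ (G₁ G₂ : AlgebraicGeometry.Scheme.{0}) (β : G₁ ⟶ F₂) (T Z : Set G₁) (b : Bool) (y : ↥((AlgebraicGeometry.Scheme.IdealSheafData.vanishingIdeal (⟨closure Z, isClosed_closure⟩ : TopologicalSpace.Closeds G₁))).subscheme) (υ₁ : G₂ ⟶ G₁) (hy : IsClosed ({(((AlgebraicGeometry.Scheme.IdealSheafData.vanishingIdeal (⟨closure Z, isClosed_closure⟩ : TopologicalSpace.Closeds G₁))).subschemeι y : G₁)} : Set G₁)), INV W G₁ β T Z b → (((AlgebraicGeometry.Scheme.IdealSheafData.vanishingIdeal (⟨closure Z, isClosed_closure⟩ : TopologicalSpace.Closeds G₁))).subschemeι y : G₁) ∈ T → IsRegularLocalRing (((AlgebraicGeometry.Scheme.IdealSheafData.vanishingIdeal (⟨closure Z, isClosed_closure⟩ : TopologicalSpace.Closeds G₁))).subscheme.presheaf.stalk y) → IsRegularLocalRing (G₁.presheaf.stalk (((AlgebraicGeometry.Scheme.IdealSheafData.vanishingIdeal (⟨closure Z, isClosed_closure⟩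 : TopologicalSpace.Closeds G₁))).subschemeι y : G₁)) → Literature.AlgebraicGeometry.Resolution.IsBlowup υ₁ (AlgebraicGeometry.Scheme.IdealSheafData.vanishingIdeal (⟨{(((AlgebraicGeometry.Scheme.IdealSheafData.vanishingIdeal (⟨closure Z, isClosed_closure⟩ : TopologicalSpace.Closeds G₁))).subschemeι y : G₁)}, hy⟩ : TopologicalSpace.Closeds G₁)) → INV W G₂ (CategoryTheory.CategoryStruct.comp υ₁ β) (closure (υ₁ ⁻¹' (T \ {(((AlgebraicGeometry.Scheme.IdealSheafData.vanishingIdeal (⟨closure Z, isClosed_closure⟩ : TopologicalSpace.Closeds G₁))).subschemeι y : G₁)}))) (closure (υ₁ ⁻¹' (Z \ {(((AlgebraicGeometry.Scheme.IdealSheafData.vanishingIdeal (⟨closure Z, isClosed_closure⟩ : TopologicalSpace.Closeds G₁))).subschemeι y : G₁)}))) b)) →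
      -- (step, flag raised) an in-carrier point blow-up at the (at most one) NON-REGULAR point
      (∀ W : Set F₁, (∀ (G₁ G₂ : AlgebraicGeometry.Scheme.{0}) (β : G₁ ⟶ F₂) (T Z : Set G₁) (y : ↥((AlgebraicGeometry.Scheme.IdealSheafData.vanishingIdeal (⟨closure Z, isClosed_closure⟩ : TopologicalSpace.Closeds G₁))).subscheme) (υ₁ : G₂ ⟶ G₁) (hy : IsClosed ({(((AlgebraicGeometry.Scheme.IdealSheafData.vanishingIdeal (⟨closure Z, isClosed_closure⟩ : TopologicalSpace.Closeds G₁))).subschemeι y : G₁)} : Set G₁)), INV W G₁ β T Z false → (((AlgebraicGeometry.Scheme.IdealSheafData.vanishingIdeal (⟨closure Z, isClosed_closure⟩ : TopologicalSpace.Closeds G₁))).subschemeι y : G₁) ∈ T → ¬ IsRegularLocalRing (((AlgebraicGeometry.Scheme.IdealSheafData.vanishingIdeal (⟨closure Z, isClosed_closure⟩ : TopologicalSpace.Closeds G₁))).subscheme.presheaf.stalk y) → IsRegularLocalRing (G₁.presheaf.stalk (((AlgebraicGeometry.Scheme.IdealSheafData.vanishingIdeal (⟨closure Z, isClosed_closure⟩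 : TopologicalSpace.Closeds G₁))).subschemeι y : G₁)) → Literature.AlgebraicGeometry.Resolution.IsBlowup υ₁ (AlgebraicGeometry.Scheme.IdealSheafData.vanishingIdeal (⟨{(((AlgebraicGeometry.Scheme.IdealSheafData.vanishingIdeal (⟨closure Z, isClosed_closure⟩ : TopologicalSpace.Closeds G₁))).subschemeι y : G₁)}, hy⟩ : TopologicalSpace.Closeds G₁)) → INV W G₂ (CategoryTheory.CategoryStruct.comp υ₁ β) (closure (υ₁ ⁻¹' (T \ {(((AlgebraicGeometry.Scheme.IdealSheafData.vanishingIdeal (⟨closure Z, isClosed_closure⟩ : TopologicalSpace.Closeds G₁))).subschemeι y : G₁)}))) (closure (υ₁ ⁻¹' (Z \ {(((AlgebraicGeometry.Scheme.IdealSheafData.vanishingIdeal (⟨closure Z, isClosed_closure⟩ : TopologicalSpace.Closeds G₁))).subschemeι y : G₁)}))) true)) →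
      -- (final) the curve step from the invariant
      (∀ (W : Set F₁) (F₉ : AlgebraicGeometry.Scheme.{0}) (β₉ : F₉ ⟶ F₂) (T₉ Z₉ : Set F₉) (b₉ : Bool) (hZ₉ : IsClosed Z₉) (F₁₀ : AlgebraicGeometry.Scheme.{0}) (υ' : F₁₀ ⟶ F₉), INV W F₉ β₉ T₉ Z₉ b₉ → (Z₉ ⊆ T₉) → (¬ (T₉ ⊆ Z₉)) → (Set.Finite {z : ↥((AlgebraicGeometry.Scheme.IdealSheafData.vanishingIdeal (⟨Z₉, hZ₉⟩ : TopologicalSpace.Closeds F₉))).subscheme | ¬ IsRegularLocalRing (((AlgebraicGeometry.Scheme.IdealSheafData.vanishingIdeal (⟨Z₉, hZ₉⟩ : TopologicalSpace.Closeds F₉))).subscheme.presheaf.stalk z)}) → (Literature.AlgebraicGeometry.Resolution.IsBlowup υ' (AlgebraicGeometry.Scheme.IdealSheafData.vanishingIdeal (⟨Z₉, hZ₉⟩ : TopologicalSpace.Closeds F₉))) → ∃ (X₉ : AlgebraicGeometry.Scheme.{0}) (σ₉ : X₉ ⟶ P) (S₉ : Set X₉) (j₉ : F₁₀ ⟶ X₉)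 (t₉ : F₁₀ ⟶ AlgebraicGeometry.Spec (.of k)), Ch X₉ σ₉ S₉ ∧ AlgebraicGeometry.IsIntegral X₉ ∧ IsLocallyNoetherian X₉ ∧ Literature.AlgebraicGeometry.Resolution.Scheme.IsRegular X₉ ∧ AlgebraicGeometry.IsDominant (σ₉ ≫ q) ∧ IsPullback j₉ t₉ (σ₉ ≫ q) (AlgebraicGeometry.Spec.map (CommRingCat.ofHom θ)) ∧ j₉ '' closure (υ' ⁻¹' (T₉ \ Z₉)) = S₉ ∧ IsClosed (closure (υ' ⁻¹' (T₉ \ Z₉))) ∧ IsIrreducible (closure (υ' ⁻¹' (T₉ \ Z₉))) ∧ AlgebraicGeometry.IsIntegral F₁₀) →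
      ∀ (F₁₀ : AlgebraicGeometry.Scheme.{0}) (β : F₁₀ ⟶ F₂) (T₁₀ : Set F₁₀), (∃ (W : Set F₁) (F₉ : AlgebraicGeometry.Scheme.{0}) (β₉ : F₉ ⟶ F₂) (T₉ Z₉ : Set F₉) (b₉ : Bool) (hZ₉ : IsClosed Z₉) (υ' : F₁₀ ⟶ F₉), (x ∈ W) ∧ (¬ (υ ⁻¹' {x} ⊆ closure (υ ⁻¹' (W \ {x})))) ∧ ((∃ U : F₁.affineOpens, x ∈ (U : F₁.Opens) ∧ ((AlgebraicGeometry.Scheme.IdealSheafData.vanishingIdeal (⟨closure W, isClosed_closure⟩ : TopologicalSpace.Closeds F₁)).ideal U).IsPrincipal)) ∧ ((υ ⁻¹' {x} ∩ closure (υ ⁻¹' (W \ {x}))) ⊆ closure (υ ⁻¹' (T₁ \ {x}))) ∧ ((∀ R : (∀ G : AlgebraicGeometry.Scheme.{0}, (G ⟶ F₂) → Set G → Set G → Bool → Prop), R F₂ (CategoryTheory.CategoryStruct.id F₂) (closure (υ ⁻¹' (T₁ \ {x}))) (υ ⁻¹' {x} ∩ closure (υ ⁻¹' (W \ {x}))) false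 → (∀ (G₁ G₂ : AlgebraicGeometry.Scheme.{0}) (β : G₁ ⟶ F₂) (T Z : Set G₁) (b : Bool) (y : ↥((AlgebraicGeometry.Scheme.IdealSheafData.vanishingIdeal (⟨closure Z, isClosed_closure⟩ : TopologicalSpace.Closeds G₁))).subscheme) (υ₁ : G₂ ⟶ G₁) (hy : IsClosed ({(((AlgebraicGeometry.Scheme.IdealSheafData.vanishingIdeal (⟨closure Z, isClosed_closure⟩ : TopologicalSpace.Closeds G₁))).subschemeι y : G₁)} : Set G₁)), R G₁ β T Z b → (((AlgebraicGeometry.Scheme.IdealSheafData.vanishingIdeal (⟨closure Z, isClosed_closure⟩ : TopologicalSpace.Closeds G₁))).subschemeι y : G₁) ∈ T → IsRegularLocalRing (((AlgebraicGeometry.Scheme.IdealSheafData.vanishingIdeal (⟨closure Z, isClosed_closure⟩ : TopologicalSpace.Closeds G₁))).subscheme.presheaf.stalk y) → IsRegularLocalRing (G₁.presheaf.stalk (((AlgebraicGeometry.Scheme.IdealSheafData.vanishingIdeal (⟨closure Z, isClosed_closure⟩ : TopologicalSpace.Closeds G₁))).subschemeι y : G₁)) → Literature.AlgebraicGeometry.Resolution.IsBlowup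 υ₁ (AlgebraicGeometry.Scheme.IdealSheafData.vanishingIdeal (⟨{(((AlgebraicGeometry.Scheme.IdealSheafData.vanishingIdeal (⟨closure Z, isClosed_closure⟩ : TopologicalSpace.Closeds G₁))).subschemeι y : G₁)}, hy⟩ : TopologicalSpace.Closeds G₁)) → R G₂ (CategoryTheory.CategoryStruct.comp υ₁ β) (closure (υ₁ ⁻¹' (T \ {(((AlgebraicGeometry.Scheme.IdealSheafData.vanishingIdeal (⟨closure Z, isClosed_closure⟩ : TopologicalSpace.Closeds G₁))).subschemeι y : G₁)}))) (closure (υ₁ ⁻¹' (Z \ {(((AlgebraicGeometry.Scheme.IdealSheafData.vanishingIdeal (⟨closure Z, isClosed_closure⟩ : TopologicalSpace.Closeds G₁))).subschemeι y : G₁)}))) b) → (∀ (G₁ G₂ : AlgebraicGeometry.Scheme.{0}) (β : G₁ ⟶ F₂) (T Z : Set G₁) (y : ↥((AlgebraicGeometry.Scheme.IdealSheafData.vanishingIdeal (⟨closure Z, isClosed_closure⟩ : TopologicalSpace.Closeds G₁))).subscheme) (υ₁ : G₂ ⟶ G₁) (hy : IsClosed ({(((AlgebraicGeometry.Scheme.IdealSheafData.vanishingIdeal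 (⟨closure Z, isClosed_closure⟩ : TopologicalSpace.Closeds G₁))).subschemeι y : G₁)} : Set G₁)), R G₁ β T Z false → (((AlgebraicGeometry.Scheme.IdealSheafData.vanishingIdeal (⟨closure Z, isClosed_closure⟩ : TopologicalSpace.Closeds G₁))).subschemeι y : G₁) ∈ T → ¬ IsRegularLocalRing (((AlgebraicGeometry.Scheme.IdealSheafData.vanishingIdeal (⟨closure Z, isClosed_closure⟩ : TopologicalSpace.Closeds G₁))).subscheme.presheaf.stalk y) → IsRegularLocalRing (G₁.presheaf.stalk (((AlgebraicGeometry.Scheme.IdealSheafData.vanishingIdeal (⟨closure Z, isClosed_closure⟩ : TopologicalSpace.Closeds G₁))).subschemeι y : G₁)) → Literature.AlgebraicGeometry.Resolution.IsBlowup υ₁ (AlgebraicGeometry.Scheme.IdealSheafData.vanishingIdeal (⟨{(((AlgebraicGeometry.Scheme.IdealSheafData.vanishingIdeal (⟨closure Z, isClosed_closure⟩ : TopologicalSpace.Closeds G₁))).subschemeι y : G₁)}, hy⟩ : TopologicalSpace.Closeds G₁)) → R G₂ (CategoryTheory.CategoryStruct.comp υ₁ β) (closure (υ₁ ⁻¹'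 (T \ {(((AlgebraicGeometry.Scheme.IdealSheafData.vanishingIdeal (⟨closure Z, isClosed_closure⟩ : TopologicalSpace.Closeds G₁))).subschemeι y : G₁)}))) (closure (υ₁ ⁻¹' (Z \ {(((AlgebraicGeometry.Scheme.IdealSheafData.vanishingIdeal (⟨closure Z, isClosed_closure⟩ : TopologicalSpace.Closeds G₁))).subschemeι y : G₁)}))) true) → R F₉ β₉ T₉ Z₉ b₉)) ∧ (Z₉ ⊆ T₉) ∧ (¬ (T₉ ⊆ Z₉)) ∧ (Set.Finite {z : ↥((AlgebraicGeometry.Scheme.IdealSheafData.vanishingIdeal (⟨Z₉, hZ₉⟩ : TopologicalSpace.Closeds F₉))).subscheme | ¬ IsRegularLocalRing (((AlgebraicGeometry.Scheme.IdealSheafData.vanishingIdeal (⟨Z₉, hZ₉⟩ : TopologicalSpace.Closeds F₉))).subscheme.presheaf.stalk z)}) ∧ (Literature.AlgebraicGeometry.Resolution.IsBlowup υ' (AlgebraicGeometry.Scheme.IdealSheafData.vanishingIdeal (⟨Z₉, hZ₉⟩ : TopologicalSpace.Closeds F₉))) ∧ β = CategoryTheory.CategoryStruct.comp υ' β₉ ∧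 T₁₀ = closure (υ' ⁻¹' (T₉ \ Z₉))) → ∃ (X₉ : AlgebraicGeometry.Scheme.{0}) (σ₉ : X₉ ⟶ P) (S₉ : Set X₉) (j₉ : F₁₀ ⟶ X₉) (t₉ : F₁₀ ⟶ AlgebraicGeometry.Spec (.of k)), Ch X₉ σ₉ S₉ ∧ AlgebraicGeometry.IsIntegral X₉ ∧ IsLocallyNoetherian X₉ ∧ Literature.AlgebraicGeometry.Resolution.Scheme.IsRegular X₉ ∧ AlgebraicGeometry.IsDominant (σ₉ ≫ q) ∧ IsPullback j₉ t₉ (σ₉ ≫ q) (AlgebraicGeometry.Spec.map (CommRingCat.ofHom θ)) ∧ j₉ '' T₁₀ = S₉ ∧ IsClosed T₁₀ ∧ IsIrreducible T₁₀ ∧ AlgebraicGeometry.IsIntegral F₁₀ := by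
  intro O _ _ _ _ _ θ hθ P q Y Ch hChStep hChSplit hYsp hYirr hYcl hPint hPnoeth hPreg hqprop hqsm X' σ' S' hCh' hX'int hX'noeth
    hX'reg hX'dom F₁ hF₁ j t hsq T₁ hT₁cl hT₁irr hjT₁ x hx U hU s hs hsU hsx hdim hxreg hsoff X₁ τ₁ hτ₁ hX₁int hX₁noeth hX₁reg
    hX₁dom F₂ hF₂ υ hυ j₂ t₂ hsq₂ hcomm hcarrier hirr₂ hCh₁ INV hbase hstep hsing hfinal F₁₀ β T₁₀ hReach
  obtain ⟨W, F₉, β₉, T₉, Z₉, b₉, hZ₉, υ', hxW, hnot, hWpr, hZ₂T₂, hinner, hZ₉T₉, hT₉Z₉, hfin₉, hυ', hβ, hT₁₀⟩ := hReach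
  subst hβ hT₁₀
  exact hfinal W F₉ β₉ T₉ Z₉ b₉ hZ₉ F₁₀ υ' (hinner (INV W) (hbase W hxW hnot hWpr hZ₂T₂) (hstep W) (hsing W)) hZ₉T₉ hT₉Z₉
    hfin₉ hυ'

end Summit.ResolutionOfSingularities.ResolutionOfSingularities.Cruxes.EquisingularLiftNat.Sections

end
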